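import Summits.BirchSwinnertonDyer.BirchSwinnertonDyer.Theorems.KolyvaginRoadThreeMethod2LocalDictionaries
import Summits.BirchSwinnertonDyer.BirchSwinnertonDyer.Theorems.KolyvaginRoadThreeZhangSupplyJumpWeil
import HarnessLib

/-!
# Route `KolyvaginRoadThree`, deciding crux `ZhangSharpFrameAtThreeHL` (item stmt-BirchSwinnertonDyer-19574):
# adapter — the binder `hjump` (global Gross-currency) from its Poitou–Tate model form
# (cell `bsd-stepL`, ACCEL seat `bsd-stepL-koly3b` g5; `--supports stmt-BirchSwinnertonDyer-19574`, helper; part XIV of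
# the `KolyvaginRoadThreeZhangSupply*` series)

HONEST FRAMING. Two theorems; 0 definitions, 0 named facts, 0 `sorry`; pure bookkeeping; closes nothing (T7).
PARTITION: O2@3 (B10) × A1 × crux 19574 × the S2-ENGINE's (Supply) binder — proves-glue.

WHAT. Parts XI–XII prove (J) for a `SelmerStructure` `𝓖` on `E[3]` in the Poitou–Tate model: for every `x₀` some
`x ∈ H¹_𝓖(K, E[3])` has `x − a • x₀ ∉ ker loc_λ` for all `a : ℤ`. The binder `hjump` of parts IX-b ∕ XIII speaks of the
relaxed group `G(n, ℓ, T)` in the tree's GLOBAL currency (`selmerLocalKer`, `ordinaryLocalKer`, `transverseLocalKer`)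
and of `torsionLocalKer_λ`. `hjump_of_selmerStructure`: given ANY Selmer structure `𝓖` whose Selmer group lies inside
`G(n, ℓ, T)` (the dictionary of its genuine local conditions with the global kernels — one inclusion suffices) and
the model form of (J) for `𝓖` at `λ = plK ℓ`, the clause of `hjump` at `(n, ℓ, T)` follows
(`ker loc_λ = torsionLocalKer_λ`, zhang3-p1's `Method2.ker_localization_eq_torsionLocalKer`).
`hjump_of_lagrangian`: the same clause END-TO-END from part XII — a Poitou–Tate family `inv` at level `3`, a Weil
pairing `e` on `E[3]`, Selmer structures `𝓕 ≤ 𝓖` on `E[3]` (strict ∕ relaxed at `λ = plK ℓ`, equal elsewhere,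
unramified outside a finite `S(T′)`), the LAGRANGIAN property of their common conditions off `λ`, finiteness of
`H¹_𝓕`, `9 < #H¹(K_λ, E[3])`, and the inclusion `H¹_𝓖 ⊆ G(n, ℓ, T)`.

References: [cite: WZhang2014, Lemma 8.2] [cite: McCallumLMS1991, Prop. 2.1].
-/

noncomputable section

open scoped Classical

namespace Summit.BirchSwinnertonDyer.Rank1Residual.X11b.Three.Koly.ZhangSupply

open WeierstrassCurve NumberField IsDedekindDomain
  Literature.NumberTheory.EllipticCurves Literature.NumberTheory.EllipticCurves.ModularForms
  Literature.NumberTheory.GaloisRepresentations Literature.NumberTheory.GaloisRepresentations.DiscreteGaloisModule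
open Summit.BirchSwinnertonDyer.Rank1Residual.X11b.Three.Koly.Method2

variable (W : WeierstrassCurve ℚ) (K : Type) [Field K] [NumberField K] [W.IsElliptic] [W.IsGloballyMinimal]
  (ι : K →+* ℂ)

/-- **`hjump` at `(n, ℓ, T)` from the Poitou–Tate model.** If the Selmer group of a Selmer structure `𝓖` on `E[3]`
lies inside the relaxed group `G(n, ℓ, T)` (`hincl`) and for every `x₀` some class of `H¹_𝓖` is off the line
`ℤ · loc_λ x₀` modulo `ker loc_λ` (`hJ`, parts XI–XII), then the clause of the binder `hjump` of
`supply_signed_of_jump_good` ∕ `supply_signed_of_jump_bound` holds at `(n, ℓ, T)`. [cite: WZhang2014, Lemma 8.2] -/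
theorem hjump_of_selmerStructure (plK : {ℓ // Zhang2014.IsKolyvaginPrime (W.conductorNorm ℤ) W K 3 ℓ} → HeightOneSpectrum (𝓞 K))
    (n : Finset {q // IsUAdmissiblePrime W K q}) (ℓ : {ℓ // Zhang2014.IsKolyvaginPrime (W.conductorNorm ℤ) W K 3 ℓ})
    (T : Finset {ℓ // Zhang2014.IsKolyvaginPrime (W.conductorNorm ℤ) W K 3 ℓ})
    (𝓖 : SelmerStructure ((W.baseChange K).torsionGaloisModule ((3 ^ 1 : ℕ) : ℤ)))
    (hincl : ∀ x ∈ 𝓖.selmerGroup,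
      (∀ w : InfinitePlace K, x ∈ selmerLocalKer (W.baseChange K) w.Completion ((3 ^ 1 : ℕ) : ℤ)) ∧
        (∀ v : HeightOneSpectrum (𝓞 K), v ≠ plK ℓ → (∀ ℓ' ∈ T, plK ℓ' ≠ v) →
          ((∀ q ∈ n, ((q : ℕ) : 𝓞 K) ∉ v.asIdeal) →
            x ∈ selmerLocalKer (W.baseChange K) (v.adicCompletion K) ((3 ^ 1 : ℕ) : ℤ)) ∧
          (∀ q ∈ n, ((q : ℕ) : 𝓞 K) ∈ v.asIdeal →
            x ∈ (W.baseChange K).ordinaryLocalKer (v.adicCompletion K) ((3 ^ 1 : ℕ) : ℤ))) ∧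
        (∀ ℓ' ∈ T, x ∈ transverseLocalKer W K ι ℓ' (plK ℓ')))
    (hJ : ∀ x₀ : V3 W K, ∃ x : V3 W K, x ∈ 𝓖.selmerGroup ∧ ∀ a : ℤ,
      (x - a • x₀ : V3 W K) ∉ (galoisCohomology.localization ((W.baseChange K).torsionGaloisModule
        ((3 ^ 1 : ℕ) : ℤ)) (Sum.inr (plK ℓ)) 1).ker) :
    ∀ x₀ : V3 W K, ∃ x : V3 W K,
      ((∀ w : InfinitePlace K, x ∈ selmerLocalKer (W.baseChange K) w.Completion ((3 ^ 1 : ℕ) : ℤ)) ∧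
        (∀ v : HeightOneSpectrum (𝓞 K), v ≠ plK ℓ → (∀ ℓ' ∈ T, plK ℓ' ≠ v) →
          ((∀ q ∈ n, ((q : ℕ) : 𝓞 K) ∉ v.asIdeal) →
            x ∈ selmerLocalKer (W.baseChange K) (v.adicCompletion K) ((3 ^ 1 : ℕ) : ℤ)) ∧
          (∀ q ∈ n, ((q : ℕ) : 𝓞 K) ∈ v.asIdeal →
            x ∈ (W.baseChange K).ordinaryLocalKer (v.adicCompletion K) ((3 ^ 1 : ℕ) : ℤ))) ∧
        (∀ ℓ' ∈ T, x ∈ transverseLocalKer W K ι ℓ' (plK ℓ'))) ∧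
      ∀ a : ℤ, x - a • x₀ ∉ (W.baseChange K).torsionLocalKer ((plK ℓ).adicCompletion K) ((3 ^ 1 : ℕ) : ℤ) := by
  intro x₀
  obtain ⟨x, hx, hxa⟩ := hJ x₀
  refine ⟨x, hincl x hx, fun a h ↦ hxa a ?_⟩
  rwa [ker_localization_eq_torsionLocalKer W K (plK ℓ)]

open Summit.BirchSwinnertonDyer.Rank1Residual.X11b.FiniteDuality Summit.BirchSwinnertonDyer.Rank1Residual.GaloisImage
  Summit.BirchSwinnertonDyer.Rank1Residual.X11b.LocBridge Summit.BirchSwinnertonDyer.Rank1Residual.X11b.Relaxation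
  Literature.NumberTheory.GaloisCohomology in
/-- **`hjump` at `(n, ℓ, T)` END-TO-END from Poitou–Tate + Weil + LAGRANGIAN conditions** (part XII
`exists_forall_sub_zsmul_not_mem_ker_localization_of_lagrangian` composed with `hjump_of_selmerStructure`). Inputs: a
Poitou–Tate family `inv` at level `3` (`IsPerfect`, `SumLocalTermEqZero`, `SelmerComplement` — the named fact
`poitouTate_selmerStructure_duality K 3`), a Weil pairing `e` on `E[3]` (`exists_weilPairing`), a finite set `T′` of
finite places off which `3` is a unit and `E[3]` unramified, Selmer structures `𝓕 ≤ 𝓖` on `E[3]` unramified outside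
`S(T′)`, equal off `λ = plK ℓ ∈ T′`, strict ∕ relaxed at `λ`, with LAGRANGIAN common conditions off `λ` (`hmax`),
`H¹_𝓕` finite, `9 < #H¹(K_λ, E[3])` (`= 81` at a Kolyvagin prime), and `H¹_𝓖 ⊆ G(n, ℓ, T)` (`hincl`, the dictionary
of the genuine conditions of `𝓖` with the global kernels). [cite: WZhang2014, Lemma 8.2] [cite: McCallumLMS1991,
Prop. 2.1 (p. 296)] [cite: MilneADT2006, Ch. I, Thm. 4.10] -/
theorem hjump_of_lagrangian
    (plK : {ℓ // Zhang2014.IsKolyvaginPrime (W.conductorNorm ℤ) W K 3 ℓ} → HeightOneSpectrum (𝓞 K))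
    (n : Finset {q // IsUAdmissiblePrime W K q}) (ℓ : {ℓ // Zhang2014.IsKolyvaginPrime (W.conductorNorm ℤ) W K 3 ℓ})
    (T : Finset {ℓ // Zhang2014.IsKolyvaginPrime (W.conductorNorm ℤ) W K 3 ℓ})
    -- a Weil pairing on `E[3]` and a Poitou–Tate family at level `3`
    (e : (W.baseChange K).geomTorsion (3 ^ 1 : ℕ) → (W.baseChange K).geomTorsion (3 ^ 1 : ℕ) → AlgebraicClosure K)
    (hμ : ∀ S T, e S T ^ (3 ^ 1 : ℕ) = 1)
    (hadd₁ : ∀ S₁ S₂ T, e (S₁ + S₂) T = e S₁ T * e S₂ T)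
    (hadd₂ : ∀ S T₁ T₂, e S (T₁ + T₂) = e S T₁ * e S T₂)
    (hgal : ∀ (σ : Field.absoluteGaloisGroup K) (S T : (W.baseChange K).geomTorsion (3 ^ 1 : ℕ)),
      σ • e S T = e (σ • S) (σ • T))
    (hnondeg : ∀ T, (∀ S, e S T = 1) → T = 0)
    (inv : LocalInvariants K (3 ^ 1 : ℕ)) (hperf : inv.IsPerfect) (hsum : inv.SumLocalTermEqZero)
    (hcompl : inv.SelmerComplement)
    -- the support and the two structures
    (T' : Finset (HeightOneSpectrum (𝓞 K)))
    (hS : ∀ v : HeightOneSpectrum (𝓞 K), v ∉ T' → (((3 ^ 1 : ℕ) : ℕ) : 𝓞 K) ∉ v.asIdeal ∧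
      GaloisRep.IsUnramifiedAt v ((W.baseChange K).torsionGaloisModule (3 ^ 1 : ℕ)))
    {𝓕 𝓖 : SelmerStructure ((W.baseChange K).torsionGaloisModule ((3 ^ 1 : ℕ) : ℤ))}
    (h𝓕 : 𝓕.IsUnramifiedOutside (finSupport T')) (h𝓖 : 𝓖.IsUnramifiedOutside (finSupport T'))
    (w : T') (hwℓ : (w : HeightOneSpectrum (𝓞 K)) = plK ℓ)
    (heq : ∀ v : Place K, v ≠ Sum.inr w.1 → 𝓕 v = 𝓖 v)
    (hstrict : 𝓕 (Sum.inr w.1) = ⊥) (hrelax : 𝓖 (Sum.inr w.1) = ⊤) (hfin : Finite 𝓕.selmerGroup)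
    (hmax : ∀ v : Place K, v ≠ Sum.inr w.1 →
      annRight (invWeilPairing (W.baseChange K) (3 ^ 1 : ℕ) e hμ hadd₁ hadd₂ hgal inv v) (𝓕 v) = 𝓕 v)
    (hw : (3 ^ 1 : ℕ) ^ 2 <
      Nat.card (galoisCohomology (((W.baseChange K).torsionGaloisModule ((3 ^ 1 : ℕ) : ℤ)).toLocal (Sum.inr w.1)) 1))
    -- the dictionary: the Selmer group of `𝓖` lies in the relaxed group `G(n, ℓ, T)`
    (hincl : ∀ x ∈ 𝓖.selmerGroup,
      (∀ w : InfinitePlace K, x ∈ selmerLocalKer (W.baseChange K) w.Completion ((3 ^ 1 : ℕ) : ℤ)) ∧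
        (∀ v : HeightOneSpectrum (𝓞 K), v ≠ plK ℓ → (∀ ℓ' ∈ T, plK ℓ' ≠ v) →
          ((∀ q ∈ n, ((q : ℕ) : 𝓞 K) ∉ v.asIdeal) →
            x ∈ selmerLocalKer (W.baseChange K) (v.adicCompletion K) ((3 ^ 1 : ℕ) : ℤ)) ∧
          (∀ q ∈ n, ((q : ℕ) : 𝓞 K) ∈ v.asIdeal →
            x ∈ (W.baseChange K).ordinaryLocalKer (v.adicCompletion K) ((3 ^ 1 : ℕ) : ℤ))) ∧
        (∀ ℓ' ∈ T, x ∈ transverseLocalKer W K ι ℓ' (plK ℓ'))) :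
    ∀ x₀ : V3 W K, ∃ x : V3 W K,
      ((∀ w : InfinitePlace K, x ∈ selmerLocalKer (W.baseChange K) w.Completion ((3 ^ 1 : ℕ) : ℤ)) ∧
        (∀ v : HeightOneSpectrum (𝓞 K), v ≠ plK ℓ → (∀ ℓ' ∈ T, plK ℓ' ≠ v) →
          ((∀ q ∈ n, ((q : ℕ) : 𝓞 K) ∉ v.asIdeal) →
            x ∈ selmerLocalKer (W.baseChange K) (v.adicCompletion K) ((3 ^ 1 : ℕ) : ℤ)) ∧
          (∀ q ∈ n, ((q : ℕ) : 𝓞 K) ∈ v.asIdeal →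
            x ∈ (W.baseChange K).ordinaryLocalKer (v.adicCompletion K) ((3 ^ 1 : ℕ) : ℤ))) ∧
        (∀ ℓ' ∈ T, x ∈ transverseLocalKer W K ι ℓ' (plK ℓ'))) ∧
      ∀ a : ℤ, x - a • x₀ ∉ (W.baseChange K).torsionLocalKer ((plK ℓ).adicCompletion K) ((3 ^ 1 : ℕ) : ℤ) := by
  haveI : Finite ((W.baseChange K).geomTorsion ((3 ^ 1 : ℕ) : ℤ)) := finite_geomTorsion_of_neZero (W.baseChange K) (3 ^ 1)
  refine hjump_of_selmerStructure W K ι plK n ℓ T 𝓖 hincl fun x₀ ↦ ?_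
  obtain ⟨x, hx, hxa⟩ := exists_forall_sub_zsmul_not_mem_ker_localization_of_lagrangian (W.baseChange K) (3 ^ 1 : ℕ)
    e hμ hadd₁ hadd₂ hgal hnondeg inv hperf hsum hcompl T' hS h𝓕 h𝓖 w heq hstrict hrelax hfin hmax hw x₀
  refine ⟨x, hx, fun a ↦ ?_⟩
  rw [← hwℓ]
  exact hxa a

end Summit.BirchSwinnertonDyer.Rank1Residual.X11b.Three.Koly.ZhangSupply

end
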